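import Summits.Langlands.Langlands.Theorems.SqrtFiveQuarticCoversSplitCartanThreeHauptmodul

/-!
# Route `SqrtFiveQuarticCovers`, crux `BoxBorelFive` (stmt-Langlands-17835): the level-`3` binder
# `b3 ∨ s3` as a `K`-point of `X₀(3)` or of `X_s⁺(3)` over `j(E)` (hauptmodul form)

Sharpening of `Theorems/SqrtFiveQuarticCoversBoxBorelFiveLevelThreeModuli.lean` (p799916): with the
`X_s⁺(3)` hauptmodul now a kernel theorem (`…SplitCartanThreeHauptmodul`, p800188), the level-`3`
hypothesis `h3` of `BoxBorelFive` (VERBATIM; also the level-`3` binder of `RefinedLocusModular` and the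
level-`3` clause of `ReductionToRefinedLocus`'s conclusion) yields modular-curve data in the SAME SHAPE as
RECORD v5's MODEL binders:

* `levelThree_hauptmoduls_of_framing` — `Δ(E) ≠ 0` and (`b3` or `s3` framing of `E[3]`) imply
  `∃ t ∈ K, t ≠ 0, c₄³·t = (t+27)(t+3)³·Δ` (`X₀(3)`: `j = (t+27)(t+3)³/t`), or `c₄ = 0` (`j = 0`), or
  `c₄³ = 1728Δ` (`j = 1728`), or `∃ u ∈ K, c₄³·u³ = 27(u+1)³(u−3)³·Δ` (`X_s⁺(3)`:
  `j = 27(u+1)³(u−3)³/u³`).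

Proved, no named fact.  HONEST STATUS: helper of stmt-Langlands-17835; the crux stays conditional on
`Box2022_theorem1_5_modular`; nothing here proves modularity of any curve.

References: [FreitasLeHungSiksek2015] §2.2; [Box2022] §1.1; J. H. Silverman, GTM 106, III.§7, Ex. 3.7.
-/

noncomputable section

set_option linter.dupNamespace false -- project-wide option (lakefile weak.linter.dupNamespace); `Summit.Langlands.Langlands` is the mandated namespace

open scoped Classical
open scoped Matrix NumberField

namespace Summit.Langlands.Langlands.Theorems.SqrtFiveQuarticCovers

open WeierstrassCurve Literature.NumberTheory.GaloisRepresentations Polynomial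

/-- **Level-`3` framings as hauptmodul values.**  For a number field `K`, `E / 𝓞 K` with `Δ(E) ≠ 0`
and a framing of `E[3]` that is Borel (`b3`) or lands in `C_s⁺(3)` (`s3`) — the binder of
`BoxBorelFive` VERBATIM —: a `K`-point of `X₀(3)` over `j(E)` (`∃ t ≠ 0, c₄³t = (t+27)(t+3)³Δ`), or
`j(E) ∈ {0, 1728}` (`c₄ = 0 ∨ c₄³ = 1728Δ`), or a `K`-point of `X_s⁺(3)` over `j(E)`
(`∃ u, c₄³u³ = 27(u+1)³(u−3)³Δ`).  Proof: `exists_X0_three_hauptmodul_of_borelThree_framing` (p799099)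
and `exists_XsplitThree_hauptmodul_of_splitCartanThree_framing` (p800188).
[cite: FreitasLeHungSiksek2015, §2.2] [cite: Box2022, §1.1] -/
theorem levelThree_hauptmoduls_of_framing (K : Type) [Field K] [NumberField K]
    (E : WeierstrassCurve (𝓞 K)) (hE : E.Δ ≠ 0)
    (h3 : ∃ ρ : Literature.NumberTheory.GaloisRepresentations.FramedGaloisRep K (ZMod 3) 2,
      (∃ e : (E.baseChange K).geomTorsion ((3 : ℕ) : ℤ) ≃+ (Fin 2 → ZMod 3),
        ∀ (σ : Field.absoluteGaloisGroup K) (P : (E.baseChange K).geomTorsion ((3 : ℕ) : ℤ)),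
          e (σ • P) = ((ρ σ : GL (Fin 2) (ZMod 3)) : Matrix (Fin 2) (Fin 2) (ZMod 3)) *ᵥ (e P)) ∧
      ((∀ σ : Field.absoluteGaloisGroup K,
          (((ρ σ : GL (Fin 2) (ZMod 3)) : Matrix (Fin 2) (Fin 2) (ZMod 3)) 1 0 = 0)) ∨
        (∀ σ : Field.absoluteGaloisGroup K, (ρ σ : GL (Fin 2) (ZMod 3)) ∈ Subgroup.closure
          ({(⟨!![1, 0; 0, 2], !![1, 0; 0, 2], by decide, by decide⟩ : GL (Fin 2) (ZMod 3)),
            (⟨!![0, 1; 1, 0], !![0, 1; 1, 0], by decide, by decide⟩ : GL (Fin 2) (ZMod 3))} :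
            Set (GL (Fin 2) (ZMod 3)))))) :
    (∃ t : K, t ≠ 0 ∧ (E.baseChange K).c₄ ^ 3 * t = (t + 27) * (t + 3) ^ 3 * (E.baseChange K).Δ) ∨
    (E.baseChange K).c₄ = 0 ∨ (E.baseChange K).c₄ ^ 3 = 1728 * (E.baseChange K).Δ ∨
    (∃ u : K, (E.baseChange K).c₄ ^ 3 * u ^ 3 = 27 * (u + 1) ^ 3 * (u - 3) ^ 3 * (E.baseChange K).Δ) := by
  obtain ⟨ρ, he, hB | hS⟩ := h3
  · exact Or.inl (exists_X0_three_hauptmodul_of_borelThree_framing K E hE ⟨ρ, he, hB⟩)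
  · exact Or.inr (exists_XsplitThree_hauptmodul_of_splitCartanThree_framing K E hE ⟨ρ, he, hS⟩)

end Summit.Langlands.Langlands.Theorems.SqrtFiveQuarticCovers

end
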